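import Mathlib
import Summits.Ventures.HodgeRepro2.T6A3DirectSumInj

/-!
# T6GradedKunneth — the Künneth algebra isomorphism, carrier-free (Mathlib-only)

Cell pub-hodge-repro2, Tier 6 (README §10), seat t6-p3 (A3 owner). Proof lane; carrier-free, Mathlib
only. The abstract core of the Layer-III identification «`H^*(B) ᵍ⊗ H^*(B) ≅ H^*(B × B)`» (T6A3ShadowFix
`IdentBB'`), extracted from the singular-cohomology drafts T6A3HostKunneth / T6A3HostKunnethIso /
T6A3HostInt so that it instantiates on EITHER host carrier — the host's `WeilCohomology` `W` (where the
Koszul sign is `W.cup_comm`, the degreewise Künneth bijectivity is `W.bijective_kunnethMap` and the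
product orientation is `W.trace_externalCup`, all FIELDS) or singular cohomology (where they are the
displays `Hatcher_Thm3_11` / `Bredon_VI_3_2_Kunneth` / t6-p2's `ProductOrientation`).

SETTING. A graded ring `⨁ i, 𝒞 i` (`DirectSum.GRing 𝒞`, `GAlgebra R 𝒞`), two internally graded
`R`-algebras `A` (grading `𝒜`) and `B` (grading `ℬ`) with algebra maps `ιX : A → ⨁ 𝒞`, `ιY : B → ⨁ 𝒞`
that are HOMOGENEOUS with explicit degree maps (`HomogeneousAlgHom`: `ιX a = of i (deg i a)` for
`a ∈ 𝒜 i`) and satisfy the Koszul rule `ιX a * ιY b = (−1)^{ji} ιY b * ιX a`.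
* `crossAlgHom : 𝒜 ᵍ⊗[R] ℬ →ₐ[R] ⨁ 𝒞` (`GradedTensorProduct.lift`), `a ⊗ b ↦ ιX a * ιY b`;
* `kunnethMap n : ⨁_{i+j=n} 𝒜 i ⊗ ℬ j → 𝒞 n` (the degree-`n` fibre of the piece maps
  `a ⊗ b ↦ deg i a · deg j b`); its antidiagonal-indexed form `kunnethMapAnti` (the shape of the
  host's `kunnethMap`) is in the companion T6GradedKunnethInt;
* THE THEOREM: `crossAlgHom` is injective / surjective / bijective as soon as every `kunnethMap n` is
  (`crossLin_eq`: `crossAlgHom` is the degree-respecting assembly of the piece maps after the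
  decomposition `A ⊗ B ≅ ⨁ 𝒜 i ⊗ ℬ j`; T6A3DirectSumInj for the injectivity), giving `crossAlgEquiv`;
* THE INTEGRAL IDENTITY (`int_crossAlgHom`, companion file T6GradedKunnethInt): for functionals
  `intX`, `intY`, `intXY` killing all degrees but the top ones `dX`, `dY`, `dX + dY`, with the gradings
  vanishing above their tops and the product orientation on the top bidegree,
  `intXY (crossAlgHom w) = intPair intX intY w` for every `w`.

§8(d): uses an L-value-free non-vanishing device: NO.
-/

namespace Summit.Ventures.HodgeRepro2.T6.GradedKunneth

open DirectSum
open scoped DirectSum TensorProduct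

variable {R : Type*} [CommRing R]
variable {𝒞 : ℕ → Type*} [∀ i, AddCommGroup (𝒞 i)] [∀ i, Module R (𝒞 i)] [GRing 𝒞] [GAlgebra R 𝒞]
variable {A B : Type*} [Ring A] [Ring B] [Algebra R A] [Algebra R B]

/-! ## 1. Homogeneous algebra maps into a graded ring -/

/-- An algebra map `ι : A → ⨁ 𝒞` from an internally graded algebra, HOMOGENEOUS with explicit degree
maps: `ι a = of i (deg i a)` for `a` of degree `i`. -/
structure HomogeneousAlgHom (𝒜 : ℕ → Submodule R A) (ι : A →ₐ[R] ⨁ i, 𝒞 i) where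
  /-- the degree-`i` map -/
  deg : ∀ i, 𝒜 i →ₗ[R] 𝒞 i
  /-- `ι` on a homogeneous element is the degree map followed by the inclusion of the degree -/
  eq : ∀ (i : ℕ) (a : 𝒜 i), ι a = of 𝒞 i (deg i a)

variable {𝒜 : ℕ → Submodule R A} {ℬ : ℕ → Submodule R B}
  {ιX : A →ₐ[R] ⨁ i, 𝒞 i} {ιY : B →ₐ[R] ⨁ i, 𝒞 i}

/-- The Koszul rule for `ιX`, `ιY` from the sign rule of the graded ring on homogeneous elements. -/
theorem anti_commutes (HX : HomogeneousAlgHom 𝒜 ιX) (HY : HomogeneousAlgHom ℬ ιY)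
    (hsign : ∀ (i j : ℕ) (x : 𝒞 i) (y : 𝒞 j),
      of 𝒞 i x * of 𝒞 j y = ((-1 : ℤˣ) ^ (j * i)) • (of 𝒞 j y * of 𝒞 i x)) :
    ∀ ⦃i j : ℕ⦄ (a : 𝒜 i) (b : ℬ j), ιX a * ιY b = ((-1 : ℤˣ) ^ (j * i)) • (ιY b * ιX a) := by
  intro i j a b
  rw [HX.eq, HY.eq]
  exact hsign i j _ _

/-! ## 2. The Künneth algebra map and its linear form -/

section cross

variable [GradedAlgebra 𝒜] [GradedAlgebra ℬ]

/-- THE KÜNNETH ALGEBRA MAP `𝒜 ᵍ⊗[R] ℬ →ₐ[R] ⨁ 𝒞`, `a ⊗ b ↦ ιX a * ιY b` (Mathlib's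
`GradedTensorProduct.lift`, with the Koszul rule as its anti-commutation requirement). -/
noncomputable def crossAlgHom
    (hcomm : ∀ ⦃i j : ℕ⦄ (a : 𝒜 i) (b : ℬ j), ιX a * ιY b = ((-1 : ℤˣ) ^ (j * i)) • (ιY b * ιX a)) :
    GradedTensorProduct R 𝒜 ℬ →ₐ[R] ⨁ i, 𝒞 i :=
  GradedTensorProduct.lift 𝒜 ℬ ιX ιY hcomm

/-- `crossAlgHom (a ⊗ b) = ιX a * ιY b`. -/
theorem crossAlgHom_tmul
    (hcomm : ∀ ⦃i j : ℕ⦄ (a : 𝒜 i) (b : ℬ j), ιX a * ιY b = ((-1 : ℤˣ) ^ (j * i)) • (ιY b * ιX a))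
    (a : A) (b : B) :
    crossAlgHom hcomm (GradedTensorProduct.tmul R a b : GradedTensorProduct R 𝒜 ℬ) = ιX a * ιY b :=
  GradedTensorProduct.lift_tmul 𝒜 ℬ _ _ _ a b

end cross

/-- The bilinear map `(a, b) ↦ ιX a * ιY b`, lifted to `A ⊗ B`. -/
noncomputable def crossLin (ιX : A →ₐ[R] ⨁ i, 𝒞 i) (ιY : B →ₐ[R] ⨁ i, 𝒞 i) :
    A ⊗[R] B →ₗ[R] ⨁ i, 𝒞 i :=
  TensorProduct.lift ((LinearMap.mul R (⨁ i, 𝒞 i)).compl₁₂ ιX.toLinearMap ιY.toLinearMap)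

/-- `crossLin (a ⊗ b) = ιX a * ιY b`. -/
theorem crossLin_tmul (a : A) (b : B) : crossLin ιX ιY (a ⊗ₜ[R] b) = ιX a * ιY b := by
  simp [crossLin]

section cross

variable [GradedAlgebra 𝒜] [GradedAlgebra ℬ]

/-- `crossAlgHom` is `crossLin` on the underlying tensor product. -/
theorem crossAlgHom_of
    (hcomm : ∀ ⦃i j : ℕ⦄ (a : 𝒜 i) (b : ℬ j), ιX a * ιY b = ((-1 : ℤˣ) ^ (j * i)) • (ιY b * ιX a))
    (w : A ⊗[R] B) :
    crossAlgHom hcomm (GradedTensorProduct.of R 𝒜 ℬ w) = crossLin ιX ιY w := by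
  induction w using TensorProduct.induction_on with
  | zero => simp
  | tmul a b =>
    show crossAlgHom hcomm (GradedTensorProduct.tmul R a b) = _
    rw [crossAlgHom_tmul, crossLin_tmul]
  | add x y hx hy => simp only [map_add, hx, hy]

end cross

/-! ## 3. The piece maps, the decomposition, and the factorisation of `crossLin` -/

/-- The total degree `(i, j) ↦ i + j`. -/
def totalDeg (ij : ℕ × ℕ) : ℕ := ij.1 + ij.2

/-- The degree-`(i, j)` piece of the Künneth map, `𝒜 i ⊗ ℬ j → 𝒞 (i + j)`,
`a ⊗ b ↦ deg i a · deg j b` (the graded multiplication of `𝒞`). -/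
noncomputable def pieceMap (HX : HomogeneousAlgHom 𝒜 ιX) (HY : HomogeneousAlgHom ℬ ιY) (ij : ℕ × ℕ) :
    𝒜 ij.1 ⊗[R] ℬ ij.2 →ₗ[R] 𝒞 (totalDeg ij) :=
  TensorProduct.lift ((gMulLHom R (A := 𝒞) (i := ij.1) (j := ij.2)).compl₁₂ (HX.deg ij.1) (HY.deg ij.2))

/-- `pieceMap (a ⊗ b) = deg a · deg b`. -/
theorem pieceMap_tmul (HX : HomogeneousAlgHom 𝒜 ιX) (HY : HomogeneousAlgHom ℬ ιY) (ij : ℕ × ℕ)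
    (a : 𝒜 ij.1) (b : ℬ ij.2) :
    pieceMap HX HY ij (a ⊗ₜ[R] b) = GradedMonoid.GMul.mul (HX.deg ij.1 a) (HY.deg ij.2 b) := by
  simp [pieceMap]
  rfl

section decomp

variable [GradedAlgebra 𝒜] [GradedAlgebra ℬ]

/-- The decomposition `A ⊗ B ≅ ⨁_{(i,j)} 𝒜 i ⊗ ℬ j`. -/
noncomputable def decompTensor (𝒜 : ℕ → Submodule R A) (ℬ : ℕ → Submodule R B) [GradedAlgebra 𝒜]
    [GradedAlgebra ℬ] : A ⊗[R] B ≃ₗ[R] ⨁ ij : ℕ × ℕ, 𝒜 ij.1 ⊗[R] ℬ ij.2 :=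
  (TensorProduct.congr (decomposeLinearEquiv 𝒜) (decomposeLinearEquiv ℬ)).trans
    (TensorProduct.directSum R R (fun i => 𝒜 i) (fun j => ℬ j))

/-- `crossLin` factors through the decomposition and the degree-respecting assembly of the pieces. -/
theorem crossLin_eq (HX : HomogeneousAlgHom 𝒜 ιX) (HY : HomogeneousAlgHom ℬ ιY) :
    crossLin ιX ιY =
      (DirectSumInj.assemble totalDeg (pieceMap HX HY)).comp (decompTensor 𝒜 ℬ).toLinearMap := by
  apply TensorProduct.ext'
  intro a b
  rw [LinearMap.comp_apply, LinearEquiv.coe_coe, decompTensor, LinearEquiv.trans_apply,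
    TensorProduct.congr_tmul]
  suffices key : ∀ (x : ⨁ i, 𝒜 i) (y : ⨁ j, ℬ j),
      crossLin ιX ιY ((decomposeLinearEquiv 𝒜).symm x ⊗ₜ[R] (decomposeLinearEquiv ℬ).symm y) =
        DirectSumInj.assemble totalDeg (pieceMap HX HY)
          (TensorProduct.directSum R R (fun i => 𝒜 i) (fun j => ℬ j) (x ⊗ₜ[R] y)) by
    have h := key (decomposeLinearEquiv 𝒜 a) (decomposeLinearEquiv ℬ b)
    rwa [LinearEquiv.symm_apply_apply, LinearEquiv.symm_apply_apply] at h
  intro x y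
  induction x using DirectSum.induction_on with
  | zero => simp
  | of i ai =>
    induction y using DirectSum.induction_on with
    | zero => simp
    | of j bj =>
      rw [← DirectSum.lof_eq_of R, ← DirectSum.lof_eq_of R, decomposeLinearEquiv_symm_lof,
        decomposeLinearEquiv_symm_lof, TensorProduct.directSum_lof_tmul_lof, DirectSumInj.assemble,
        DirectSum.toModule_lof, LinearMap.comp_apply, crossLin_tmul, HX.eq, HY.eq, DirectSum.of_mul_of,
        pieceMap_tmul, DirectSum.lof_eq_of]
      rfl
    | add y1 y2 h1 h2 => simp only [map_add, TensorProduct.tmul_add, h1, h2]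
  | add x1 x2 h1 h2 => simp only [map_add, TensorProduct.add_tmul, h1, h2]

end decomp

/-! ## 4. The Künneth map in degree `n` and the bijectivity theorem -/

/-- THE KÜNNETH MAP IN DEGREE `n`: `⨁_{i+j=n} 𝒜 i ⊗ ℬ j → 𝒞 n`, the fibre of the piece maps over the
total degree `n`. -/
noncomputable def kunnethMap (HX : HomogeneousAlgHom 𝒜 ιX) (HY : HomogeneousAlgHom ℬ ιY) (n : ℕ) :
    (⨁ s : {ij : ℕ × ℕ // totalDeg ij = n}, 𝒜 s.1.1 ⊗[R] ℬ s.1.2) →ₗ[R] 𝒞 n :=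
  DirectSumInj.fibreMap totalDeg (pieceMap HX HY) n

/-- `kunnethMap n` on a summand: the piece map, transported to degree `n`. -/
theorem kunnethMap_lof (HX : HomogeneousAlgHom 𝒜 ιX) (HY : HomogeneousAlgHom ℬ ιY) (n : ℕ)
    (s : {ij : ℕ × ℕ // totalDeg ij = n}) (w : 𝒜 s.1.1 ⊗[R] ℬ s.1.2) :
    kunnethMap HX HY n (DirectSum.lof R _ (fun s : {ij : ℕ × ℕ // totalDeg ij = n} =>
      𝒜 s.1.1 ⊗[R] ℬ s.1.2) s w) =
      DirectSumInj.castN (R := R) (N := 𝒞) s.2 (pieceMap HX HY s.1 w) := by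
  rw [kunnethMap, DirectSumInj.fibreMap, DirectSum.toModule_lof, LinearMap.comp_apply]

/-- `kunnethMap n` on a summand, `of` form. -/
theorem kunnethMap_of (HX : HomogeneousAlgHom 𝒜 ιX) (HY : HomogeneousAlgHom ℬ ιY) (n : ℕ)
    (s : {ij : ℕ × ℕ // totalDeg ij = n}) (w : 𝒜 s.1.1 ⊗[R] ℬ s.1.2) :
    kunnethMap HX HY n (DirectSum.of (fun s : {ij : ℕ × ℕ // totalDeg ij = n} =>
      𝒜 s.1.1 ⊗[R] ℬ s.1.2) s w) =
      DirectSumInj.castN (R := R) (N := 𝒞) s.2 (pieceMap HX HY s.1 w) := by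
  rw [← DirectSum.lof_eq_of R]
  exact kunnethMap_lof HX HY n s w

section bij

variable [GradedAlgebra 𝒜] [GradedAlgebra ℬ]
  (HX : HomogeneousAlgHom 𝒜 ιX) (HY : HomogeneousAlgHom ℬ ιY)

include HX HY in
/-- `crossLin` is injective when every `kunnethMap n` is (the degree-respecting assembly of injective
fibre maps after the decomposition, T6A3DirectSumInj). -/
theorem crossLin_injective (hk : ∀ n, Function.Injective (kunnethMap HX HY n)) :
    Function.Injective (crossLin ιX ιY) := by
  rw [crossLin_eq HX HY, LinearMap.coe_comp, LinearEquiv.coe_coe]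
  exact Function.Injective.comp (DirectSumInj.assemble_injective totalDeg (pieceMap HX HY) hk)
    (decompTensor 𝒜 ℬ).injective

/-- INJECTIVITY of the Künneth algebra map from the injectivity of its degree-`n` pieces. -/
theorem crossAlgHom_injective
    (hcomm : ∀ ⦃i j : ℕ⦄ (a : 𝒜 i) (b : ℬ j), ιX a * ιY b = ((-1 : ℤˣ) ^ (j * i)) • (ιY b * ιX a))
    (hk : ∀ n, Function.Injective (kunnethMap HX HY n)) :
    Function.Injective (crossAlgHom hcomm) := by
  intro u v huv
  have h : crossLin ιX ιY ((GradedTensorProduct.of R 𝒜 ℬ).symm u) =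
      crossLin ιX ιY ((GradedTensorProduct.of R 𝒜 ℬ).symm v) := by
    rw [← crossAlgHom_of hcomm, ← crossAlgHom_of hcomm, LinearEquiv.apply_symm_apply,
      LinearEquiv.apply_symm_apply]
    exact huv
  exact (GradedTensorProduct.of R 𝒜 ℬ).symm.injective (crossLin_injective HX HY hk h)

/-- SURJECTIVITY of the Künneth algebra map from the surjectivity of its degree-`n` pieces: every
homogeneous element of `⨁ 𝒞` is a sum of products `ιX a * ιY b`. -/
theorem crossAlgHom_surjective
    (hcomm : ∀ ⦃i j : ℕ⦄ (a : 𝒜 i) (b : ℬ j), ιX a * ιY b = ((-1 : ℤˣ) ^ (j * i)) • (ιY b * ιX a))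
    (hk : ∀ n, Function.Surjective (kunnethMap HX HY n)) :
    Function.Surjective (crossAlgHom hcomm) := by
  classical
  suffices H : ∀ (n : ℕ) (z : 𝒞 n), of 𝒞 n z ∈ (crossAlgHom hcomm).range by
    intro y
    have hy : y ∈ (crossAlgHom hcomm).range := by
      induction y using DirectSum.induction_on with
      | zero => exact Subalgebra.zero_mem _
      | of n z => exact H n z
      | add x y hx hy => exact Subalgebra.add_mem _ hx hy
    exact hy
  intro n z
  obtain ⟨t, rfl⟩ := hk n z
  induction t using DirectSum.induction_on with
  | zero =>
    rw [map_zero, map_zero]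
    exact Subalgebra.zero_mem _
  | of s w =>
    rw [kunnethMap_of]
    obtain ⟨⟨i, j⟩, hs⟩ := s
    subst hs
    induction w using TensorProduct.induction_on with
    | zero =>
      rw [map_zero, map_zero, map_zero]
      exact Subalgebra.zero_mem _
    | tmul a b =>
      refine ⟨GradedTensorProduct.tmul R a b, ?_⟩
      show crossAlgHom hcomm (GradedTensorProduct.tmul R a b) = _
      rw [crossAlgHom_tmul, HX.eq, HY.eq, DirectSum.of_mul_of, pieceMap_tmul]
      rfl
    | add x y hx hy =>
      rw [map_add, map_add, map_add]
      exact Subalgebra.add_mem _ hx hy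
  | add x y hx hy =>
    rw [map_add, map_add]
    exact Subalgebra.add_mem _ hx hy

/-- THE KÜNNETH THEOREM IN ALGEBRA FORM: the Künneth algebra map is bijective as soon as every
degree-`n` Künneth map `⨁_{i+j=n} 𝒜 i ⊗ ℬ j → 𝒞 n` is. -/
theorem crossAlgHom_bijective
    (hcomm : ∀ ⦃i j : ℕ⦄ (a : 𝒜 i) (b : ℬ j), ιX a * ιY b = ((-1 : ℤˣ) ^ (j * i)) • (ιY b * ιX a))
    (hk : ∀ n, Function.Bijective (kunnethMap HX HY n)) :
    Function.Bijective (crossAlgHom hcomm) :=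
  ⟨crossAlgHom_injective HX HY hcomm fun n => (hk n).1,
    crossAlgHom_surjective HX HY hcomm fun n => (hk n).2⟩

/-- The Künneth algebra isomorphism `𝒜 ᵍ⊗[R] ℬ ≃ₐ[R] ⨁ 𝒞`. -/
noncomputable def crossAlgEquiv
    (hcomm : ∀ ⦃i j : ℕ⦄ (a : 𝒜 i) (b : ℬ j), ιX a * ιY b = ((-1 : ℤˣ) ^ (j * i)) • (ιY b * ιX a))
    (hk : ∀ n, Function.Bijective (kunnethMap HX HY n)) :
    GradedTensorProduct R 𝒜 ℬ ≃ₐ[R] ⨁ i, 𝒞 i :=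
  AlgEquiv.ofBijective (crossAlgHom hcomm) (crossAlgHom_bijective HX HY hcomm hk)

/-- `crossAlgEquiv` acts as `crossAlgHom`. -/
theorem crossAlgEquiv_apply
    (hcomm : ∀ ⦃i j : ℕ⦄ (a : 𝒜 i) (b : ℬ j), ιX a * ιY b = ((-1 : ℤˣ) ^ (j * i)) • (ιY b * ιX a))
    (hk : ∀ n, Function.Bijective (kunnethMap HX HY n)) (w : GradedTensorProduct R 𝒜 ℬ) :
    crossAlgEquiv HX HY hcomm hk w = crossAlgHom hcomm w := rfl

end bij

end Summit.Ventures.HodgeRepro2.T6.GradedKunneth
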